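import Literature.Computability.AlgebraicComplexity.VNCTwo
import Literature.Computability.AlgebraicComplexity.DepthReductionProofs
import Literature.Computability.AlgebraicComplexity.VPDeterminantalQPProofs
import Literature.Computability.AlgebraicComplexity.CircuitGateSemantics
import Literature.Computability.AlgebraicComplexity.VNPeEqVNP
import HarnessLib

/-!
# `VP ⊆ VNC²` (Bürgisser–Clausen–Shokrollahi 1997, Cor. (21.38)) — discharge

Discharge (D-0014) of the named fact
`Literature.Computability.AlgebraicComplexity.BCS1997_cor_21_38_VP_subset_VNC2` (`VNCTwo.lean`):
`theorem BCS1997_cor_21_38_VP_subset_VNC2_holds`, proved over every commutative semiring of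
coefficients (the fact asks for a field).

## The printed proof and its transcription

BCS 1997, Thm. (21.36) (Hyafil; Valiant–Skyum–Berkowitz–Rackoff 1983): an `n`-variate polynomial
`f` of degree `d` with `L(f) = s` has a straight-line program of length `poly(s, d)` and depth
`O(log(ds) log d + log n)`; Cor. (21.38): `VP = VNC²`. The proof ((C)–(H), pp. 566–568):
homogenize the program (Lemma (21.25)), introduce the gate quotients `b_{ij}` ((C), (D)), the
antichains `Γ_b(a)` and the identities (E), and compute in STAGES (F): stage `δ + 1` obtains every
value / gate quotient of degree in `(2^δ, 2^{δ+1}]` as a sum of at most `r` (= number of nodes)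
products of three quantities known from stage `δ` ((G), (H)); each stage is a program of depth
`O(log r)` (a balanced binary tree of additions under one layer of products), there are
`⌈log₂ d⌉` stages, and stage `0` consists of linear forms (depth `O(log n)`).

The algebra of (C)–(H) is in the tree already (sorry-free, `GateQuotients.lean`, written for
Tavenas' depth reduction; the same identification is used in `VPDeterminantalQPProofs.lean`):
`DepthReduction.SLP.homogenize d` is the homogenization on `≤ 4L(d+1)²` nodes
(`SLP.card_node_le`), `HomCircuit.quot` is the gate quotient, `frontier m` is `Γ_b(m)`,
`val_eq_sum_frontier` / `quot_eq_sum_frontier` are the identities (E), and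
`HomCircuit.expandAtom` is ONE stage of (G)/(H) in the `×`-balanced form of Agrawal–Vinay/Tavenas:
an atom (`[ν]` or `[ν : μ]`) of formal degree `D ≥ 2` is the sum of at most `#ι²` products of at
most `5` atoms of formal degree `≤ D/2` (`expandAtom_sum`, `expandAtom_half`,
`expandAtom_length_le`, `length_expandAtom_le`); atoms of formal degree `≤ 1` have affine values
(`totalDegree_aval_le`).

This file supplies what (21.36)/(21.38) need beyond that: an explicit SHARED fan-in-two circuit
in the tree's model (`ArithCircuit`, depth = `ArithCircuit.depth`) realising the stages, with its
value, depth, size and fan-in bookkeeping, and the final arithmetic.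

## Contents

* Per-gate depth API (`ArithCircuit.gateD`, `Operand.depE`, `Operand.valE`, `gateD_le_succ`,
  `depth_le_depE_output`), companion to `CircuitGateSemantics.lean`.
* `ArithCircuit.UnitSpec` and `UnitSpec.circuit`: a circuit made of `U` consecutive UNITS of the
  same shape — `4K` product gates (`K` chains of `4` binary products, i.e. products of `5`
  operands), `K·κ` sum gates (a balanced binary tree over `K = 2^κ` weighted leaves) and one result
  gate — whose operands/leaves are supplied by functions `popnd`, `leaf` of the unit number; local
  semantics `gateVal_prod`, `gateVal_sum`, `gateVal_result` and depth bounds `gateD_prod_le`,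
  `gateD_sum_le`, `gateD_result_le`; `isFanInTwo_circuit`, `size_circuit`.
* The VSBR instantiation (`DepthReduction.HomCircuit.vsbrSpec`; atoms are a finite type of
  cardinality `A = #ι + #ι²` by `HomCircuit.instFintypeAtom` / `card_atom` of
  `VNPeEqVNP.lean`): unit `A·j + #a` (stage `j ≤ J`, atom number `#a < A`) computes the atom `a`
  if its formal degree is `≤ 2^j`: at stage
  `0` as an affine form (`affLeaf`, `eq_sum_smul_X_add_C`), at stage `j + 1` as the sum of the
  products of `expandAtom a` read from stage `j` (or a copy of stage `j` for affine atoms); one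
  final unit sums a list of node values. Invariants `gateVal_resAt` (values) and `gateD_resAt_le`
  (depth `≤ (j+1)(κ+5)`), whence `HomCircuit.exists_circuit_depth`: fan-in two, size
  `(4·2^κ + κ2^κ + 1)(A(J+1) + 1)`, depth `≤ (J+2)(κ+5)`.
* `exists_circuit_of_two_pow_bounds`: `deg g + 1, #σ + 1, L(g) ≤ 2^E` ⟹ a fan-in-two circuit for
  `g` of size `≤ 2^{28E}` and depth `≤ 45E²` (via `DepthReduction.exists_slp`,
  `SLP.homogenize`, `SLP.exists_circuit_depth` with `κ = 6E + 4`, `J = E`); and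
  `exists_isPBounded_size_depth_le_of_isVPFamily`: for a `VP` family,
  `E = (log₂ n + 1)·A'` (`IsPBounded.exists_lt_two_pow` of `VPDeterminantalQPProofs.lean`), so
  the size `≤ 2^{28A'(log₂ n+1)} ≤ 2^{28A'}(n+1)^{28A'}` is p-bounded and the depth is
  `≤ 45A'²(log₂ n + 1)²`; the discharge `BCS1997_cor_21_38_VP_subset_VNC2_holds` is the instance
  `Field k`.

## Comparison with the printed theorem

BCS state length `O(d⁶ s³)` and depth `O(log(ds) log d + log n)`; here the size is a (much worse
but) fixed polynomial in `s, d, n` and the depth is `(E+2)(6E+9)` for `d, n, s < 2^E`, i.e.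
`O(log²(dsn))` — for p-bounded `d, s, n` both are `poly(n)` and `O(log² n)`, which is exactly what
the fact (= Cor. (21.38), `VP ⊆ VNC²`) states; nothing is asserted beyond the fact as vendored. The
stage depth here is `κ + 5` with one uniform `κ = O(log(#nodes² + n + d))` for all stages (BCS use
`O(log r)` per stage and `O(log n)` once, at stage `0`).

## References

* P. Bürgisser, M. Clausen, M. A. Shokrollahi, *Algebraic Complexity Theory*, Springer 1997
  [BurgisserClausenShokrollahi1997], §21.5: Thm. (21.36) and its proof (C)–(H), Def. (21.37),
  Cor. (21.38) (pp. 565–569; PDF pp. 594–598 of the held scan).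
* L. G. Valiant, S. Skyum, S. Berkowitz, C. Rackoff, *Fast parallel computation of polynomials
  using few processors*, SIAM J. Comput. 12 (1983) 641–644 [ValiantSkyumBerkowitzRackoff1983].
* P. Bürgisser, *Completeness and Reduction in Algebraic Complexity Theory*, Springer 2000,
  Def. 2.1 [Burgisser2000] (the circuit model).
-/

noncomputable section

open MvPolynomial

namespace Literature.Computability.AlgebraicComplexity

universe u v w

/-! ## Part 1. Per-gate depth and index-free operand semantics -/

namespace ArithCircuit

variable {k : Type u} {σ : Type v}

/-- The depth of gate number `i` of `P` (every gate weighs `1`; junk `0` out of range)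
(Bürgisser 2000, Def. 2.1; BCS 1997, §21.5: the depth `D` of Sect. 4.1, recalled on p. 563, and
Def. (21.37), depth of a straight-line program).
[cite: BurgisserClausenShokrollahi1997, Def. (21.37), p. 568 (PDF p. 597); depth p. 563] -/
def gateD (P : ArithCircuit k σ) (i : ℕ) : ℕ := (gateWDepths (fun _ => 1) P.gates).getD i 0

/-- The depth of the gate an operand refers to (no index guard; `0` for variables and constants).
[cite: BurgisserClausenShokrollahi1997, Def. (21.37), p. 568 (PDF p. 597)] -/
def Operand.depE (P : ArithCircuit k σ) : Operand k σ → ℕ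
  | .var _ => 0
  | .const _ => 0
  | .gate j => P.gateD j

/-- Unfolding `depE` on a gate reference. [folklore] -/
@[simp] theorem Operand.depE_gate (P : ArithCircuit k σ) (j : ℕ) :
    (Operand.gate j : Operand k σ).depE P = P.gateD j := rfl

/-- Unfolding `depE` on a variable. [folklore] -/
@[simp] theorem Operand.depE_var (P : ArithCircuit k σ) (x : σ) :
    (Operand.var x : Operand k σ).depE P = 0 := rfl

/-- Unfolding `depE` on a constant. [folklore] -/
@[simp] theorem Operand.depE_const (P : ArithCircuit k σ) (c : k) :
    (Operand.const c : Operand k σ).depE P = 0 := rfl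

/-- The depth of an operand read by gate `i` is at most the depth of the gate it refers to (a
forward reference reads the junk depth `0`). [folklore] -/
theorem depthIn_take_le_depE (P : ArithCircuit k σ) (i : ℕ) (u : Operand k σ) :
    u.depthIn (gateWDepths (fun _ => 1) (P.gates.take i)) ≤ u.depE P := by
  cases u with
  | var v => exact le_rfl
  | const c => exact le_rfl
  | gate j =>
    change (gateWDepths (fun _ => 1) (P.gates.take i)).getD j 0 ≤ P.gateD j
    rw [gateWDepths_take_eq_take, List.getD_eq_getElem?_getD, List.getElem?_take]
    split_ifs with h
    · rw [gateD, List.getD_eq_getElem?_getD]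
    · exact Nat.zero_le _

/-- **A gate is one deeper than its deepest operand**: if every operand of gate `i` refers to a
gate of depth `≤ D` (or is an input), then gate `i` has depth `≤ D + 1` (the depth of Sect. 4.1 of
BCS 1997, recalled in §21.5).
[cite: BurgisserClausenShokrollahi1997, Def. (21.37), p. 568 (PDF p. 597)] -/
theorem gateD_le_succ (P : ArithCircuit k σ) {i : ℕ} {g : Gate k σ} (hg : P.gates[i]? = some g)
    {D : ℕ} (h : ∀ u ∈ g.args, u.depE P ≤ D) : P.gateD i ≤ D + 1 := by
  unfold gateD
  rw [List.getD_eq_getElem?_getD, gateWDepths_getElem? (fun _ => 1) P.gates i g hg,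
    Option.getD_some, Nat.add_comm]
  refine Nat.add_le_add_right (DepthReduction.foldr_max_le fun x hx => ?_) 1
  obtain ⟨u, hu, rfl⟩ := List.mem_map.1 hx
  exact (P.depthIn_take_le_depE i u).trans (h u hu)

/-- The depth of a circuit is at most the depth of the gate its output refers to. [folklore] -/
theorem depth_le_depE_output (P : ArithCircuit k σ) : P.depth ≤ P.output.depE P := by
  have h := P.depthIn_take_le_depE P.size P.output
  rw [size, List.take_length] at h
  exact h

/-- `RefsBelow` is monotone in the bound (a private copy: the public name lives in a `Summits/`
theorem file, which a Literature file cannot import). [folklore] -/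
private theorem Operand.refsBelow_mono_vnc {m n : ℕ} (h : m ≤ n) {u : Operand k σ}
    (hu : u.RefsBelow m) : u.RefsBelow n := by
  cases u with
  | var i => trivial
  | const c => trivial
  | gate j => exact lt_of_lt_of_le hu h

variable [CommSemiring k]

/-- The value of the gate an operand refers to (no index guard; variables and constants denote
themselves) (Bürgisser 2000, Def. 2.1). [cite: Burgisser2000, Def. 2.1] -/
def Operand.valE (P : ArithCircuit k σ) : Operand k σ → MvPolynomial σ k
  | .var v => X v
  | .const c => C c
  | .gate j => P.gateVal j

/-- Unfolding `valE` on a gate reference. [folklore] -/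
@[simp] theorem Operand.valE_gate (P : ArithCircuit k σ) (j : ℕ) :
    (Operand.gate j : Operand k σ).valE P = P.gateVal j := rfl

/-- Unfolding `valE` on a variable. [folklore] -/
@[simp] theorem Operand.valE_var (P : ArithCircuit k σ) (x : σ) :
    (Operand.var x : Operand k σ).valE P = X x := rfl

/-- Unfolding `valE` on a constant. [folklore] -/
@[simp] theorem Operand.valE_const (P : ArithCircuit k σ) (c : k) :
    (Operand.const c : Operand k σ).valE P = C c := rfl

/-- A backward reference read by gate `i` denotes the value of the gate it refers to
(Bürgisser 2000, Def. 2.1). [cite: Burgisser2000, Def. 2.1] -/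
theorem opVal_eq_valE (P : ArithCircuit k σ) {i : ℕ} {u : Operand k σ} (hu : u.RefsBelow i) :
    P.opVal i u = u.valE P := by
  cases u with
  | var v => rfl
  | const c => rfl
  | gate j => exact if_pos hu

end ArithCircuit

/-! ## Part 2. Circuits made of uniform units (product chains + balanced sum trees) -/

namespace ArithCircuit

variable {k : Type u} {σ : Type v}

/-- The number `K = 2^κ` of leaves (and of product chains) of a unit. [folklore] -/
def unitK (κ : ℕ) : ℕ := 2 ^ κ

/-- The number of gates of a unit: `4K` product gates, `K·κ` sum gates, one result gate.
[folklore] -/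
def unitG (κ : ℕ) : ℕ := 4 * unitK κ + unitK κ * κ + 1

/-- Specification of a circuit made of `U` uniform units: `κ` (so `K = 2^κ` leaves per unit), the
number of units `U`, the five operands `popnd u τ q` (`q < 5`) of the `τ`-th product chain of unit
`u`, and the weighted leaves `leaf u τ` (`τ < K`) of the sum tree of unit `u` (the parallel stages
of VSBR 1983 / BCS 1997, proof of Thm. (21.36), (F): sums of `≤ r` triple products per stage,
realised with fan-in two).
[cite: BurgisserClausenShokrollahi1997, Thm. (21.36) (proof, (F)–(H)), pp. 567–568] -/
structure UnitSpec (k : Type u) (σ : Type v) where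
  /-- logarithm of the number of leaves per unit -/
  κ : ℕ
  /-- number of units -/
  U : ℕ
  /-- operand `q` of product chain `τ` of unit `u` -/
  popnd : ℕ → ℕ → ℕ → Operand k σ
  /-- weighted leaf `τ` of the sum tree of unit `u` -/
  leaf : ℕ → ℕ → k × Operand k σ

namespace UnitSpec

variable (S : UnitSpec k σ)

/-- Leaves per unit. [folklore] -/
def K : ℕ := unitK S.κ

/-- Gates per unit. [folklore] -/
def G : ℕ := unitG S.κ

/-- Absolute index of local gate `loc` of unit `u`. [folklore] -/
def idx (u loc : ℕ) : ℕ := S.G * u + loc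

/-- Absolute index of the result gate of unit `u`. [folklore] -/
def resIdx (u : ℕ) : ℕ := S.idx u (4 * S.K + S.K * S.κ)

/-! ### Index arithmetic -/

/-- `K = 2^κ ≥ 1`. [folklore] -/
theorem one_le_K : 1 ≤ S.K := Nat.one_le_two_pow

/-- `G > 0`. [folklore] -/
theorem G_pos : 0 < S.G := Nat.succ_pos _

/-- `G = 4K + Kκ + 1`, unfolded. [folklore] -/
theorem G_eq : S.G = 4 * S.K + S.K * S.κ + 1 := rfl

/-- Indices inside one unit are ordered as their local parts. [folklore] -/
theorem idx_lt_idx_iff {u a b : ℕ} : S.idx u a < S.idx u b ↔ a < b := by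
  unfold idx; omega

/-- Indices inside one unit are ordered as their local parts. [folklore] -/
theorem idx_le_idx_iff {u a b : ℕ} : S.idx u a ≤ S.idx u b ↔ a ≤ b := by
  unfold idx; omega

/-- A local gate of an earlier unit comes before every gate of a later unit. [folklore] -/
theorem idx_lt_idx_of_lt {u u' loc : ℕ} (hu : u' < u) (hloc : loc < S.G) :
    S.idx u' loc < S.idx u 0 := by
  unfold idx
  have h1 : S.G * (u' + 1) ≤ S.G * u := Nat.mul_le_mul_left _ hu
  have h2 : S.G * (u' + 1) = S.G * u' + S.G := Nat.mul_succ _ _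
  omega

/-- The result gate of an earlier unit comes before every gate of a later unit. [folklore] -/
theorem resIdx_lt_idx {u u' : ℕ} (hu : u' < u) : S.resIdx u' < S.idx u 0 :=
  S.idx_lt_idx_of_lt hu (by rw [G_eq]; omega)

/-- Every local gate index lies inside the gate list. [folklore] -/
theorem idx_lt_size {u loc : ℕ} (hu : u < S.U) (hloc : loc < S.G) : S.idx u loc < S.G * S.U := by
  unfold idx
  have h1 : S.G * (u + 1) ≤ S.G * S.U := Nat.mul_le_mul_left _ hu
  have h2 : S.G * (u + 1) = S.G * u + S.G := Nat.mul_succ _ _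
  omega

/-- `2^(κ-1-t) · 2^(t+1) = K` for `t < κ`. [folklore] -/
theorem two_pow_mul_two_pow {t : ℕ} (ht : t < S.κ) : 2 ^ (S.κ - 1 - t) * 2 ^ (t + 1) = S.K := by
  rw [K, unitK, ← pow_add]
  congr 1
  omega

section Gates

variable [CommSemiring k]

/-- Local gate `loc` of unit `u`: for `loc = 4τ + p < 4K` the `p`-th gate of product chain `τ`
(`p = 0`: `popnd 0 * popnd 1`; `p ≥ 1`: previous gate `* popnd (p+1)`); for
`loc = 4K + K t + m` the sum gate `(t, m)` of the balanced tree (`t = 0`: `leaf (2m) + leaf (2m+1)`;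
`t ≥ 1`: gate `(t-1, 2m)` `+` gate `(t-1, 2m+1)`); finally the result gate, a copy of the root
`(κ - 1, 0)`. [cite: BurgisserClausenShokrollahi1997, Thm. (21.36) (proof, (F)), p. 567] -/
def gateAt (u loc : ℕ) : Gate k σ :=
  if loc < 4 * S.K then
    if loc % 4 = 0 then .prod [S.popnd u (loc / 4) 0, S.popnd u (loc / 4) 1]
    else .prod [.gate (S.idx u (loc - 1)), S.popnd u (loc / 4) (loc % 4 + 1)]
  else if loc < 4 * S.K + S.K * S.κ then
    if (loc - 4 * S.K) / S.K = 0 then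
      .sum [S.leaf u (2 * ((loc - 4 * S.K) % S.K)), S.leaf u (2 * ((loc - 4 * S.K) % S.K) + 1)]
    else
      .sum [(1, .gate (S.idx u (4 * S.K + S.K * ((loc - 4 * S.K) / S.K - 1) +
              2 * ((loc - 4 * S.K) % S.K)))),
            (1, .gate (S.idx u (4 * S.K + S.K * ((loc - 4 * S.K) / S.K - 1) +
              2 * ((loc - 4 * S.K) % S.K) + 1)))]
  else .sum [(1, .gate (S.idx u (4 * S.K + S.K * (S.κ - 1))))]

/-- The circuit of a unit specification: units `0, …, U-1` in order, output = result gate of the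
last unit. [cite: BurgisserClausenShokrollahi1997, Thm. (21.36) (proof, (F)), p. 567] -/
def circuit : ArithCircuit k σ where
  gates := (List.range (S.G * S.U)).map fun i => S.gateAt (i / S.G) (i % S.G)
  output := .gate (S.G * S.U - 1)

/-- The size of the circuit is `G · U`. [folklore] -/
theorem size_circuit : S.circuit.size = S.G * S.U := by
  simp [circuit, ArithCircuit.size]

/-- The gate list at a local index. [folklore] -/
theorem gates_getElem? {u loc : ℕ} (hu : u < S.U) (hloc : loc < S.G) :
    S.circuit.gates[S.idx u loc]? = some (S.gateAt u loc) := by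
  have hlt : S.G * u + loc < S.G * S.U := S.idx_lt_size hu hloc
  show ((List.range (S.G * S.U)).map fun i => S.gateAt (i / S.G) (i % S.G))[S.G * u + loc]? = _
  rw [List.getElem?_map, List.getElem?_range hlt, Option.map_some, Nat.mul_add_div S.G_pos,
    Nat.mul_add_mod, Nat.div_eq_of_lt hloc, Nat.mod_eq_of_lt hloc, Nat.add_zero]

/-- **Fan-in two**: every gate of the circuit has at most two operands.
[cite: Burgisser2000, Def. 2.1] -/
theorem isFanInTwo_circuit : S.circuit.IsFanInTwo := by
  intro g hg
  simp only [circuit, List.mem_map, List.mem_range] at hg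
  obtain ⟨i, -, rfl⟩ := hg
  unfold gateAt
  split_ifs <;> simp [Gate.fanIn, Gate.args]

/-! ### Unfolding the local gates -/

/-- First gate of product chain `τ`. [folklore] -/
theorem gateAt_prod_zero {u τ : ℕ} (hτ : τ < S.K) :
    S.gateAt u (4 * τ + 0) = .prod [S.popnd u τ 0, S.popnd u τ 1] := by
  have h1 : 4 * τ + 0 < 4 * S.K := by omega
  have h2 : (4 * τ + 0) % 4 = 0 := by omega
  have h3 : (4 * τ + 0) / 4 = τ := by omega
  simp only [gateAt, if_pos h1, h2, h3, if_true]

/-- Later gates of product chain `τ`. [folklore] -/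
theorem gateAt_prod_succ {u τ p : ℕ} (hτ : τ < S.K) (hp : p + 1 < 4) :
    S.gateAt u (4 * τ + (p + 1)) = .prod [.gate (S.idx u (4 * τ + p)), S.popnd u τ (p + 2)] := by
  have h1 : 4 * τ + (p + 1) < 4 * S.K := by omega
  have h2 : (4 * τ + (p + 1)) % 4 = p + 1 := by omega
  have h3 : (4 * τ + (p + 1)) / 4 = τ := by omega
  have h4 : 4 * τ + (p + 1) - 1 = 4 * τ + p := by omega
  simp only [gateAt, if_pos h1, h2, h3, h4, Nat.add_one_ne_zero, if_false]

/-- Bottom layer of the sum tree. [folklore] -/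
theorem gateAt_sum_zero {u m : ℕ} (hκ : 1 ≤ S.κ) (hm : m < S.K) :
    S.gateAt u (4 * S.K + S.K * 0 + m) = .sum [S.leaf u (2 * m), S.leaf u (2 * m + 1)] := by
  have h1 : ¬ 4 * S.K + S.K * 0 + m < 4 * S.K := by omega
  have hK : S.K ≤ S.K * S.κ := Nat.le_mul_of_pos_right _ hκ
  have h2 : 4 * S.K + S.K * 0 + m < 4 * S.K + S.K * S.κ := by rw [Nat.mul_zero]; omega
  have h3 : 4 * S.K + S.K * 0 + m - 4 * S.K = m := by rw [Nat.mul_zero]; omega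
  have h4 : m / S.K = 0 := Nat.div_eq_of_lt hm
  have h5 : m % S.K = m := Nat.mod_eq_of_lt hm
  simp only [gateAt, if_neg h1, if_pos h2, h3, h4, h5, if_true]

/-- Higher layers of the sum tree. [folklore] -/
theorem gateAt_sum_succ {u t m : ℕ} (ht : t + 2 ≤ S.κ) (hm : m < S.K) :
    S.gateAt u (4 * S.K + S.K * (t + 1) + m) =
      .sum [(1, .gate (S.idx u (4 * S.K + S.K * t + 2 * m))),
        (1, .gate (S.idx u (4 * S.K + S.K * t + 2 * m + 1)))] := by
  have h1 : ¬ 4 * S.K + S.K * (t + 1) + m < 4 * S.K := by omega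
  have hK : S.K * (t + 2) ≤ S.K * S.κ := Nat.mul_le_mul_left _ ht
  have hK' : S.K * (t + 2) = S.K * (t + 1) + S.K := Nat.mul_succ _ _
  have h2 : 4 * S.K + S.K * (t + 1) + m < 4 * S.K + S.K * S.κ := by omega
  have h3 : 4 * S.K + S.K * (t + 1) + m - 4 * S.K = S.K * (t + 1) + m := by omega
  have h4 : (S.K * (t + 1) + m) / S.K = t + 1 := by
    rw [Nat.mul_add_div (lt_of_lt_of_le (Nat.zero_lt_of_lt hm) le_rfl), Nat.div_eq_of_lt hm,
      Nat.add_zero]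
  have h5 : (S.K * (t + 1) + m) % S.K = m := by rw [Nat.mul_add_mod, Nat.mod_eq_of_lt hm]
  simp only [gateAt, if_neg h1, if_pos h2, h3, h4, h5, Nat.add_one_ne_zero, if_false,
    Nat.add_sub_cancel]

/-- The result gate. [folklore] -/
theorem gateAt_result (u : ℕ) :
    S.gateAt u (4 * S.K + S.K * S.κ) = .sum [(1, .gate (S.idx u (4 * S.K + S.K * (S.κ - 1))))] := by
  have h1 : ¬ 4 * S.K + S.K * S.κ < 4 * S.K := by omega
  have h2 : ¬ 4 * S.K + S.K * S.κ < 4 * S.K + S.K * S.κ := lt_irrefl _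
  simp only [gateAt, if_neg h1, if_neg h2]

/-! ### Local semantics: values -/

/-- The value of leaf `τ` of unit `u`: its weight times the value of its operand. [folklore] -/
def leafVal (u τ : ℕ) : MvPolynomial σ k := (S.leaf u τ).1 • (S.leaf u τ).2.valE S.circuit

/-- **Product chains**: gate `p` of chain `τ` of unit `u` computes `∏_{q < p+2} popnd u τ q`
(operands referring to earlier units).
[cite: BurgisserClausenShokrollahi1997, Thm. (21.36) (proof, (G)–(H)), p. 568] -/
theorem gateVal_prod {u τ : ℕ} (hu : u < S.U) (hτ : τ < S.K)
    (hpop : ∀ q, (S.popnd u τ q).RefsBelow (S.idx u 0)) :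
    ∀ p, p < 4 → S.circuit.gateVal (S.idx u (4 * τ + p)) =
      ∏ q ∈ Finset.range (p + 2), (S.popnd u τ q).valE S.circuit
  | 0, _ => by
    have hg := S.gates_getElem? hu (loc := 4 * τ + 0) (by rw [G_eq]; omega)
    rw [S.gateAt_prod_zero hτ] at hg
    rw [S.circuit.gateVal_of_prod hg]
    simp only [List.map_cons, List.map_nil, List.prod_cons, List.prod_nil, mul_one]
    have hle : S.idx u 0 ≤ S.idx u (4 * τ + 0) := S.idx_le_idx_iff.2 (Nat.zero_le _)
    rw [S.circuit.opVal_eq_valE (Operand.refsBelow_mono_vnc hle (hpop 0)),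
      S.circuit.opVal_eq_valE (Operand.refsBelow_mono_vnc hle (hpop 1))]
    simp [Finset.prod_range_succ]
  | p + 1, hp => by
    have ih := gateVal_prod hu hτ hpop p (by omega)
    have hg := S.gates_getElem? hu (loc := 4 * τ + (p + 1)) (by rw [G_eq]; omega)
    rw [S.gateAt_prod_succ hτ hp] at hg
    rw [S.circuit.gateVal_of_prod hg]
    simp only [List.map_cons, List.map_nil, List.prod_cons, List.prod_nil, mul_one, opVal_gate]
    rw [if_pos (S.idx_lt_idx_iff.2 (by omega)), ih,
      S.circuit.opVal_eq_valE
        (Operand.refsBelow_mono_vnc (S.idx_le_idx_iff.2 (Nat.zero_le _)) (hpop (p + 2))),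
      show p + 1 + 2 = (p + 2) + 1 by ring, Finset.prod_range_succ _ (p + 2)]

/-- The last gate of product chain `τ` computes the product of its five operands.
[cite: BurgisserClausenShokrollahi1997, Thm. (21.36) (proof, (G)–(H)), p. 568] -/
theorem gateVal_prod_three {u τ : ℕ} (hu : u < S.U) (hτ : τ < S.K)
    (hpop : ∀ q, (S.popnd u τ q).RefsBelow (S.idx u 0)) :
    S.circuit.gateVal (S.idx u (4 * τ + 3)) =
      ∏ q ∈ Finset.range 5, (S.popnd u τ q).valE S.circuit :=
  S.gateVal_prod hu hτ hpop 3 (by norm_num)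

/-- **The sum tree**: gate `(t, m)` (`t < κ`, `m < 2^(κ-1-t)`) of unit `u` computes the sum of the
leaves `2^(t+1) m, …, 2^(t+1) (m+1) - 1` (leaves referring below the sum gates).
[cite: BurgisserClausenShokrollahi1997, Thm. (21.36) (proof, (F)), p. 567] -/
theorem gateVal_sum {u : ℕ} (hu : u < S.U)
    (hleaf : ∀ τ, τ < S.K → (S.leaf u τ).2.RefsBelow (S.idx u (4 * S.K))) :
    ∀ t, t < S.κ → ∀ m, m < 2 ^ (S.κ - 1 - t) →
      S.circuit.gateVal (S.idx u (4 * S.K + S.K * t + m)) =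
        ∑ τ ∈ Finset.range (2 ^ (t + 1)), S.leafVal u (2 ^ (t + 1) * m + τ)
  | 0, ht, m, hm => by
    have hK := S.two_pow_mul_two_pow ht
    rw [Nat.sub_zero, zero_add, pow_one] at hK
    rw [Nat.sub_zero] at hm
    have hmK : 2 * m + 1 < S.K := by omega
    have hKκ : S.K ≤ S.K * S.κ := Nat.le_mul_of_pos_right _ ht
    have hg := S.gates_getElem? hu (loc := 4 * S.K + S.K * 0 + m) (by rw [G_eq]; omega)
    rw [S.gateAt_sum_zero (by omega) (by omega)] at hg
    rw [S.circuit.gateVal_of_sum hg]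
    simp only [List.map_cons, List.map_nil, List.sum_cons, List.sum_nil, add_zero]
    have hle : S.idx u (4 * S.K) ≤ S.idx u (4 * S.K + S.K * 0 + m) := S.idx_le_idx_iff.2 (by omega)
    rw [S.circuit.opVal_eq_valE (Operand.refsBelow_mono_vnc hle (hleaf (2 * m) (by omega))),
      S.circuit.opVal_eq_valE (Operand.refsBelow_mono_vnc hle (hleaf (2 * m + 1) hmK))]
    simp [Finset.sum_range_succ, leafVal]
  | t + 1, ht, m, hm => by
    have hK := S.two_pow_mul_two_pow ht
    have hK1 := S.two_pow_mul_two_pow (Nat.lt_of_succ_lt ht)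
    have h4 : 4 ≤ 2 ^ (t + 1 + 1) := by
      rw [pow_succ, pow_succ]
      have := Nat.one_le_two_pow (n := t)
      omega
    have hm4 : m * 4 < 2 ^ (S.κ - 1 - (t + 1)) * 2 ^ (t + 1 + 1) :=
      lt_of_lt_of_le (Nat.mul_lt_mul_of_pos_right hm (by norm_num)) (Nat.mul_le_mul_left _ h4)
    rw [hK] at hm4
    have hK4 : 4 ≤ S.K := hK ▸ h4.trans (Nat.le_mul_of_pos_left _ (Nat.two_pow_pos _))
    have hpow : 2 ^ (S.κ - 1 - t) = 2 ^ (S.κ - 1 - (t + 1)) * 2 := by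
      rw [← pow_succ]; congr 1; omega
    have hm2 : 2 * m + 1 < 2 ^ (S.κ - 1 - t) := by rw [hpow]; omega
    have hg := S.gates_getElem? hu (loc := 4 * S.K + S.K * (t + 1) + m) (by
      rw [G_eq]
      have h1 : S.K * (t + 2) ≤ S.K * S.κ := Nat.mul_le_mul_left _ ht
      have h2 : S.K * (t + 2) = S.K * (t + 1) + S.K := Nat.mul_succ _ _
      omega)
    rw [S.gateAt_sum_succ ht (by omega)] at hg
    rw [S.circuit.gateVal_of_sum hg]
    simp only [List.map_cons, List.map_nil, List.sum_cons, List.sum_nil, add_zero, opVal_gate,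
      one_smul]
    have hKt : S.K * (t + 1) = S.K * t + S.K := Nat.mul_succ _ _
    rw [if_pos (S.idx_lt_idx_iff.2 (by omega)), if_pos (S.idx_lt_idx_iff.2 (by omega)),
      gateVal_sum hu hleaf t (Nat.lt_of_succ_lt ht) (2 * m) (by omega),
      show 4 * S.K + S.K * t + 2 * m + 1 = 4 * S.K + S.K * t + (2 * m + 1) by omega,
      gateVal_sum hu hleaf t (Nat.lt_of_succ_lt ht) (2 * m + 1) hm2,
      show 2 ^ (t + 1 + 1) = 2 ^ (t + 1) + 2 ^ (t + 1) by ring, Finset.sum_range_add]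
    congr 1
    · refine Finset.sum_congr rfl fun x _ => ?_
      congr 1; ring
    · refine Finset.sum_congr rfl fun x _ => ?_
      congr 1; ring

/-- **The result gate** of unit `u` computes the sum of all `K` leaves of the unit.
[cite: BurgisserClausenShokrollahi1997, Thm. (21.36) (proof, (F)), p. 567] -/
theorem gateVal_result {u : ℕ} (hu : u < S.U) (hκ : 1 ≤ S.κ)
    (hleaf : ∀ τ, τ < S.K → (S.leaf u τ).2.RefsBelow (S.idx u (4 * S.K))) :
    S.circuit.gateVal (S.resIdx u) = ∑ τ ∈ Finset.range S.K, S.leafVal u τ := by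
  have hg := S.gates_getElem? hu (loc := 4 * S.K + S.K * S.κ) (by rw [G_eq]; omega)
  rw [S.gateAt_result] at hg
  rw [resIdx, S.circuit.gateVal_of_sum hg]
  simp only [List.map_cons, List.map_nil, List.sum_cons, List.sum_nil, add_zero, opVal_gate,
    one_smul]
  have hKκ : S.K * S.κ = S.K * (S.κ - 1) + S.K := by
    rw [← Nat.mul_succ]; congr 1; omega
  have hK1 := S.one_le_K
  rw [if_pos (S.idx_lt_idx_iff.2 (by omega))]
  have h := S.gateVal_sum hu hleaf (S.κ - 1) (by omega) 0 (by
    rw [show S.κ - 1 - (S.κ - 1) = 0 by omega, pow_zero]; exact Nat.one_pos)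
  rw [Nat.add_zero, Nat.mul_zero] at h
  rw [h, show S.κ - 1 + 1 = S.κ by omega]
  simp only [zero_add]
  rfl

/-- The circuit computes the value of the result gate of its last unit. [folklore] -/
theorem eval_circuit (hU : 1 ≤ S.U) : S.circuit.eval = S.circuit.gateVal (S.resIdx (S.U - 1)) := by
  rw [S.circuit.eval_eq_opVal_output, size_circuit]
  have hGU : S.G * S.U = S.G * (S.U - 1) + S.G := by
    rw [← Nat.mul_succ]; congr 1; omega
  have hres : S.resIdx (S.U - 1) = S.G * S.U - 1 := by
    rw [resIdx, idx, hGU, G_eq]; omega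
  have hlt : S.G * S.U - 1 < S.G * S.U := Nat.sub_lt (Nat.mul_pos S.G_pos hU) Nat.one_pos
  change S.circuit.opVal (S.G * S.U) (.gate (S.G * S.U - 1)) = _
  rw [opVal_gate, if_pos hlt, hres]


/-! ### Local semantics: depths -/

/-- Product chains add at most `4` to the depth of their operands.
[cite: BurgisserClausenShokrollahi1997, Thm. (21.36) (proof, (F)), p. 567] -/
theorem gateD_prod_le {u τ D : ℕ} (hu : u < S.U) (hτ : τ < S.K)
    (hpop : ∀ q, (S.popnd u τ q).depE S.circuit ≤ D) :
    ∀ p, p < 4 → S.circuit.gateD (S.idx u (4 * τ + p)) ≤ D + p + 1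
  | 0, _ => by
    have hg := S.gates_getElem? hu (loc := 4 * τ + 0) (by rw [G_eq]; omega)
    rw [S.gateAt_prod_zero hτ] at hg
    refine S.circuit.gateD_le_succ hg fun w hw => ?_
    simp only [Gate.args, List.mem_cons, List.not_mem_nil, or_false] at hw
    rcases hw with rfl | rfl
    · exact hpop 0
    · exact hpop 1
  | p + 1, hp => by
    have ih := gateD_prod_le hu hτ hpop p (by omega)
    have hg := S.gates_getElem? hu (loc := 4 * τ + (p + 1)) (by rw [G_eq]; omega)
    rw [S.gateAt_prod_succ hτ hp] at hg
    rw [show D + (p + 1) + 1 = (D + p + 1) + 1 by ring]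
    refine S.circuit.gateD_le_succ hg fun w hw => ?_
    simp only [Gate.args, List.mem_cons, List.not_mem_nil, or_false] at hw
    rcases hw with rfl | rfl
    · exact ih
    · exact (hpop (p + 2)).trans (by omega)

/-- The last gate of a product chain has depth at most `D + 4` if its operands have depth `≤ D`.
[cite: BurgisserClausenShokrollahi1997, Thm. (21.36) (proof, (F)), p. 567] -/
theorem gateD_prod_three_le {u τ D : ℕ} (hu : u < S.U) (hτ : τ < S.K)
    (hpop : ∀ q, (S.popnd u τ q).depE S.circuit ≤ D) :
    S.circuit.gateD (S.idx u (4 * τ + 3)) ≤ D + 4 :=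
  S.gateD_prod_le hu hτ hpop 3 (by norm_num)

/-- Layer `t` of the sum tree has depth at most `D + t + 1` if the leaves have depth `≤ D`.
[cite: BurgisserClausenShokrollahi1997, Thm. (21.36) (proof, (F)), p. 567] -/
theorem gateD_sum_le {u D : ℕ} (hu : u < S.U)
    (hleaf : ∀ τ, τ < S.K → (S.leaf u τ).2.depE S.circuit ≤ D) :
    ∀ t, t < S.κ → ∀ m, m < 2 ^ (S.κ - 1 - t) →
      S.circuit.gateD (S.idx u (4 * S.K + S.K * t + m)) ≤ D + t + 1
  | 0, ht, m, hm => by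
    have hK := S.two_pow_mul_two_pow ht
    rw [Nat.sub_zero, zero_add, pow_one] at hK
    rw [Nat.sub_zero] at hm
    have hmK : 2 * m + 1 < S.K := by omega
    have hKκ : S.K ≤ S.K * S.κ := Nat.le_mul_of_pos_right _ ht
    have hg := S.gates_getElem? hu (loc := 4 * S.K + S.K * 0 + m) (by rw [G_eq]; omega)
    rw [S.gateAt_sum_zero (by omega) (by omega)] at hg
    refine S.circuit.gateD_le_succ hg fun w hw => ?_
    simp only [Gate.args, List.map_cons, List.map_nil, List.mem_cons, List.not_mem_nil,
      or_false] at hw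
    rcases hw with rfl | rfl
    · exact hleaf _ (by omega)
    · exact hleaf _ hmK
  | t + 1, ht, m, hm => by
    have hK := S.two_pow_mul_two_pow ht
    have h4 : 4 ≤ 2 ^ (t + 1 + 1) := by
      rw [pow_succ, pow_succ]
      have := Nat.one_le_two_pow (n := t)
      omega
    have hm4 : m * 4 < 2 ^ (S.κ - 1 - (t + 1)) * 2 ^ (t + 1 + 1) :=
      lt_of_lt_of_le (Nat.mul_lt_mul_of_pos_right hm (by norm_num)) (Nat.mul_le_mul_left _ h4)
    rw [hK] at hm4
    have hK4 : 4 ≤ S.K := hK ▸ h4.trans (Nat.le_mul_of_pos_left _ (Nat.two_pow_pos _))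
    have hpow : 2 ^ (S.κ - 1 - t) = 2 ^ (S.κ - 1 - (t + 1)) * 2 := by
      rw [← pow_succ]; congr 1; omega
    have hm2 : 2 * m + 1 < 2 ^ (S.κ - 1 - t) := by rw [hpow]; omega
    have hg := S.gates_getElem? hu (loc := 4 * S.K + S.K * (t + 1) + m) (by
      rw [G_eq]
      have h1 : S.K * (t + 2) ≤ S.K * S.κ := Nat.mul_le_mul_left _ ht
      have h2 : S.K * (t + 2) = S.K * (t + 1) + S.K := Nat.mul_succ _ _
      omega)
    rw [S.gateAt_sum_succ ht (by omega)] at hg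
    rw [show D + (t + 1) + 1 = (D + t + 1) + 1 by ring]
    refine S.circuit.gateD_le_succ hg fun w hw => ?_
    simp only [Gate.args, List.map_cons, List.map_nil, List.mem_cons, List.not_mem_nil,
      or_false] at hw
    rcases hw with rfl | rfl
    · exact gateD_sum_le hu hleaf t (Nat.lt_of_succ_lt ht) (2 * m) (by omega)
    · exact gateD_sum_le hu hleaf t (Nat.lt_of_succ_lt ht) (2 * m + 1) hm2

/-- **The result gate** of unit `u` has depth at most `D + κ + 1` if the leaves have depth `≤ D`:
one unit (= one VSBR stage) costs depth `O(log K)`.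
[cite: BurgisserClausenShokrollahi1997, Thm. (21.36) (proof, (F)), p. 567] -/
theorem gateD_result_le {u D : ℕ} (hu : u < S.U) (hκ : 1 ≤ S.κ)
    (hleaf : ∀ τ, τ < S.K → (S.leaf u τ).2.depE S.circuit ≤ D) :
    S.circuit.gateD (S.resIdx u) ≤ D + S.κ + 1 := by
  have hg := S.gates_getElem? hu (loc := 4 * S.K + S.K * S.κ) (by rw [G_eq]; omega)
  rw [S.gateAt_result] at hg
  rw [resIdx, show D + S.κ + 1 = (D + (S.κ - 1) + 1) + 1 by omega]
  refine S.circuit.gateD_le_succ hg fun w hw => ?_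
  simp only [Gate.args, List.map_cons, List.map_nil, List.mem_cons, List.not_mem_nil,
    or_false] at hw
  subst hw
  have h := S.gateD_sum_le hu hleaf (S.κ - 1) (by omega) 0 (by
    rw [show S.κ - 1 - (S.κ - 1) = 0 by omega, pow_zero]; exact Nat.one_pos)
  rw [Nat.add_zero] at h
  exact h

/-- The depth of the circuit is at most the depth of the result gate of its last unit. [folklore] -/
theorem depth_circuit_le (hU : 1 ≤ S.U) :
    S.circuit.depth ≤ S.circuit.gateD (S.resIdx (S.U - 1)) := by
  refine S.circuit.depth_le_depE_output.trans (le_of_eq ?_)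
  have hGU : S.G * S.U = S.G * (S.U - 1) + S.G := by
    rw [← Nat.mul_succ]; congr 1; omega
  have hres : S.resIdx (S.U - 1) = S.G * S.U - 1 := by
    rw [resIdx, idx, hGU, G_eq]; omega
  rw [hres]
  rfl

end Gates

end UnitSpec

end ArithCircuit

/-! ## Part 3. The VSBR instantiation -/

namespace DepthReduction

open ArithCircuit

/-! ### Padding lists read through `getElem?` -/

/-- A product over `range n` of a list read through `getElem?` and padded with `1`. [folklore] -/
theorem prod_range_getElem?_elim {α M : Type*} [CommMonoid M] (f : α → M) :
    ∀ (l : List α) (n : ℕ), l.length ≤ n →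
      ∏ q ∈ Finset.range n, (l[q]?).elim 1 f = (l.map f).prod
  | [], n, _ => by simp
  | a :: l, 0, h => by simp at h
  | a :: l, n + 1, h => by
    rw [Finset.prod_range_succ', List.map_cons, List.prod_cons, mul_comm]
    simp only [List.getElem?_cons_succ, List.getElem?_cons_zero, Option.elim_some]
    rw [prod_range_getElem?_elim f l n (by simpa using h)]

/-- A sum over `range n` of a list read through `getElem?` and padded with `0`. [folklore] -/
theorem sum_range_getElem?_elim {α M : Type*} [AddCommMonoid M] (f : α → M) :
    ∀ (l : List α) (n : ℕ), l.length ≤ n →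
      ∑ q ∈ Finset.range n, (l[q]?).elim 0 f = (l.map f).sum
  | [], n, _ => by simp
  | a :: l, 0, h => by simp at h
  | a :: l, n + 1, h => by
    rw [Finset.sum_range_succ', List.map_cons, List.sum_cons, add_comm]
    simp only [List.getElem?_cons_succ, List.getElem?_cons_zero, Option.elim_some]
    rw [sum_range_getElem?_elim f l n (by simpa using h)]

/-! ### Affine polynomials -/

section Affine

variable {k : Type u} [CommSemiring k] {σ : Type v}

/-- A monomial of degree `≤ 1` is `1` or a variable. [folklore] -/
theorem eq_zero_or_single_of_sum_le_one {m : σ →₀ ℕ} (h : (m.sum fun _ e => e) ≤ 1) :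
    m = 0 ∨ ∃ v, m = Finsupp.single v 1 := by
  classical
  have hc : Multiset.card (Finsupp.toMultiset m) ≤ 1 := by
    rw [Finsupp.card_toMultiset]; exact h
  rcases Nat.le_one_iff_eq_zero_or_eq_one.1 hc with h0 | h1
  · left
    have h0' : Finsupp.toMultiset m = 0 := Multiset.card_eq_zero.1 h0
    rw [Finsupp.toMultiset_eq_iff.1 h0', map_zero]
  · right
    obtain ⟨a, ha⟩ := Multiset.card_eq_one.1 h1
    exact ⟨a, by rw [Finsupp.toMultiset_eq_iff.1 ha, Multiset.toFinsupp_singleton]⟩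

/-- **Affine polynomials**: a polynomial of total degree `≤ 1` is `Σ_v coeff(X_v) · X_v + coeff(1)`
(the linear forms of stage `0` of BCS 1997, proof of Thm. (21.36), (F)). [folklore] -/
theorem eq_sum_smul_X_add_C [Fintype σ] {p : MvPolynomial σ k} (hp : p.totalDegree ≤ 1) :
    p = ∑ v : σ, coeff (Finsupp.single v 1) p • X v + C (coeff 0 p) := by
  classical
  set S : Finset (σ →₀ ℕ) := insert 0 (Finset.univ.image fun v : σ => Finsupp.single v 1)
    with hS
  have hsub : p.support ⊆ S := fun m hm => by
    rcases eq_zero_or_single_of_sum_le_one ((le_totalDegree hm).trans hp) with rfl | ⟨v, rfl⟩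
    · exact Finset.mem_insert_self _ _
    · exact Finset.mem_insert_of_mem (Finset.mem_image.2 ⟨v, Finset.mem_univ _, rfl⟩)
  have h0 : (0 : σ →₀ ℕ) ∉ Finset.univ.image fun v : σ => Finsupp.single v 1 := by
    simp only [Finset.mem_image, Finset.mem_univ, true_and, not_exists]
    intro v hv
    exact one_ne_zero (Finsupp.single_eq_zero.1 hv)
  calc p = ∑ m ∈ p.support, monomial m (coeff m p) := p.as_sum
    _ = ∑ m ∈ S, monomial m (coeff m p) :=
        Finset.sum_subset hsub fun m _ hm => by rw [notMem_support_iff.1 hm, map_zero]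
    _ = monomial 0 (coeff 0 p) +
          ∑ m ∈ Finset.univ.image (fun v : σ => Finsupp.single v 1), monomial m (coeff m p) :=
        Finset.sum_insert h0
    _ = C (coeff 0 p) + ∑ v : σ, monomial (Finsupp.single v 1) (coeff (Finsupp.single v 1) p) := by
        rw [Finset.sum_image fun v _ w _ h => Finsupp.single_left_injective one_ne_zero h]
        rfl
    _ = ∑ v : σ, coeff (Finsupp.single v 1) p • X v + C (coeff 0 p) := by
        rw [add_comm]
        congr 1
        refine Finset.sum_congr rfl fun v _ => ?_
        rw [show (X v : MvPolynomial σ k) = monomial (Finsupp.single v 1) 1 from rfl, smul_monomial,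
          smul_eq_mul, mul_one]

end Affine


namespace HomCircuit

/-! ### Atoms as a finite type -/

section AtomFintype

variable {ι : Type w}

variable [Fintype ι]

/-- The number of an atom. [folklore] -/
def aIdx (a : Atom ι) : ℕ := (Fintype.equivFin (Atom ι) a : ℕ)

/-- Atom numbers are `< #atoms`. [folklore] -/
theorem aIdx_lt (a : Atom ι) : aIdx a < Fintype.card (Atom ι) := (Fintype.equivFin (Atom ι) a).isLt

/-- Unit numbers: the atom is recovered by remainder. [folklore] -/
theorem unit_mod (j : ℕ) (a : Atom ι) :
    (Fintype.card (Atom ι) * j + aIdx a) % Fintype.card (Atom ι) = aIdx a := by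
  rw [Nat.mul_add_mod, Nat.mod_eq_of_lt (aIdx_lt a)]

/-- Unit numbers of stages `≤ J` are `< A (J + 1)`. [folklore] -/
theorem unit_lt {j J : ℕ} (hj : j ≤ J) (a : Atom ι) :
    Fintype.card (Atom ι) * j + aIdx a < Fintype.card (Atom ι) * (J + 1) := by
  have h1 : Fintype.card (Atom ι) * (j + 1) ≤ Fintype.card (Atom ι) * (J + 1) :=
    Nat.mul_le_mul_left _ (Nat.succ_le_succ hj)
  have h2 : Fintype.card (Atom ι) * (j + 1) = Fintype.card (Atom ι) * j + Fintype.card (Atom ι) :=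
    Nat.mul_succ _ _
  have := aIdx_lt a
  omega

/-- The index of the result gate of (stage `j`, atom `a`) in a circuit with units of `2^κ`
leaves. [folklore] -/
def resAt (κ j : ℕ) (a : Atom ι) : ℕ :=
  unitG κ * (Fintype.card (Atom ι) * j + aIdx a) + (4 * unitK κ + unitK κ * κ)

variable [Inhabited ι]

/-- The atom with a given number (junk `node default` out of range). [folklore] -/
def aOf (n : ℕ) : Atom ι :=
  if h : n < Fintype.card (Atom ι) then (Fintype.equivFin (Atom ι)).symm ⟨n, h⟩ else .node default

/-- `aOf` inverts `aIdx`. [folklore] -/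
theorem aOf_aIdx (a : Atom ι) : aOf (aIdx a) = a := by
  unfold aOf aIdx
  rw [dif_pos (Fintype.equivFin (Atom ι) a).isLt, Fin.eta, Equiv.symm_apply_apply]

/-- There is at least one atom. [folklore] -/
theorem card_atom_pos : 0 < Fintype.card (Atom ι) :=
  Fintype.card_pos_iff.2 ⟨.node default⟩

/-- Unit numbers: stage `j`, atom `a` ↦ `A j + #a`; the stage is recovered by division.
[folklore] -/
theorem unit_div (j : ℕ) (a : Atom ι) :
    (Fintype.card (Atom ι) * j + aIdx a) / Fintype.card (Atom ι) = j := by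
  rw [Nat.mul_add_div card_atom_pos, Nat.div_eq_of_lt (aIdx_lt a), Nat.add_zero]

end AtomFintype

variable {k : Type u} [CommSemiring k] {σ : Type v} [Fintype σ] {ι : Type w} [Fintype ι]
  [DecidableEq ι] [Inhabited ι]
variable (H : HomCircuit k σ ι) (J κ : ℕ)

/-! ### The unit specification of the VSBR circuit -/

/-- Operand `q` of product chain `τ` of unit `u = A j + #a`, `j ≥ 1`: the `q`-th atom of the `τ`-th
term of `expandAtom a`, read from stage `j - 1` (padding: `1` inside a term, `0` beyond the
terms); junk `0` for stage `0` and the final unit.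
[cite: BurgisserClausenShokrollahi1997, Thm. (21.36) (proof, (G)–(H)), p. 568] -/
def vsbrPopnd (u τ q : ℕ) : Operand k σ :=
  if 1 ≤ u / Fintype.card (Atom ι) ∧ u < Fintype.card (Atom ι) * (J + 1) then
    ((H.expandAtom (aOf (u % Fintype.card (Atom ι))))[τ]?).elim (.const 0) fun T =>
      (T[q]?).elim (.const 1) fun b => .gate (resAt κ (u / Fintype.card (Atom ι) - 1) b)
  else .const 0

/-- The affine leaves of an atom of formal degree `≤ 1`: `coeff(X_v) · X_v` for the `τ`-th variable
`v`, then `coeff(1) · 1`, then zeros (stage `0` of BCS 1997, proof of Thm. (21.36), (F): linear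
forms). [cite: BurgisserClausenShokrollahi1997, Thm. (21.36) (proof, (F)), p. 567] -/
def affLeaf (a : Atom ι) (τ : ℕ) : k × Operand k σ :=
  if h : τ < Fintype.card σ then
    (coeff (Finsupp.single ((Fintype.equivFin σ).symm ⟨τ, h⟩) 1) (H.aval a),
      .var ((Fintype.equivFin σ).symm ⟨τ, h⟩))
  else if τ = Fintype.card σ then (coeff 0 (H.aval a), .const 1) else (0, .const 0)

/-- Leaf `τ` of unit `u`: stage `0`: the affine leaves; stage `j ≥ 1`: a copy of stage `j - 1` for
an atom of formal degree `≤ 1`, else the `τ`-th product chain of the unit; final unit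
`u = A (J + 1)`: the result gates of stage `J` of the nodes listed in `outs`.
[cite: BurgisserClausenShokrollahi1997, Thm. (21.36) (proof, (F)–(H)), pp. 567–568] -/
def vsbrLeaf (outs : List ι) (u τ : ℕ) : k × Operand k σ :=
  if u < Fintype.card (Atom ι) * (J + 1) then
    if u / Fintype.card (Atom ι) = 0 then H.affLeaf (aOf (u % Fintype.card (Atom ι))) τ
    else if H.adeg (aOf (u % Fintype.card (Atom ι))) ≤ 1 then
      (if τ = 0 then
        (1, .gate (resAt κ (u / Fintype.card (Atom ι) - 1)
          (aOf (ι := ι) (u % Fintype.card (Atom ι)))))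
      else (0, .const 0))
    else (1, .gate (unitG κ * u + (4 * τ + 3)))
  else (outs[τ]?).elim (0, .const 0) fun ν => (1, .gate (resAt κ J (.node ν)))

/-- **The VSBR circuit** as a unit specification: `A (J + 1)` stage units and one final unit.
[cite: BurgisserClausenShokrollahi1997, Thm. (21.36) (proof, (F)–(H)), pp. 567–568] -/
def vsbrSpec (outs : List ι) : UnitSpec k σ where
  κ := κ
  U := Fintype.card (Atom ι) * (J + 1) + 1
  popnd := H.vsbrPopnd J κ
  leaf := H.vsbrLeaf J κ outs

variable (outs : List ι)

/-- `K = 2^κ`. [folklore] -/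
theorem vsbrSpec_K : (H.vsbrSpec J κ outs).K = 2 ^ κ := rfl

/-- The result index of (stage `j`, atom `a`) is the result index of unit `A j + #a`. [folklore] -/
theorem resAt_eq (j : ℕ) (a : Atom ι) :
    resAt κ j a = (H.vsbrSpec J κ outs).resIdx (Fintype.card (Atom ι) * j + aIdx a) := rfl

/-- Stage units lie inside the circuit. [folklore] -/
theorem unit_lt_U {j : ℕ} (hj : j ≤ J) (a : Atom ι) :
    Fintype.card (Atom ι) * j + aIdx a < (H.vsbrSpec J κ outs).U :=
  (unit_lt hj a).trans (Nat.lt_succ_self _)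

/-- A result gate of stage `j` comes before every gate of a unit `u > A j + #b`. [folklore] -/
theorem resAt_lt_idx {j u : ℕ} (b : Atom ι) (hu : Fintype.card (Atom ι) * (j + 1) ≤ u) :
    resAt κ j b < (H.vsbrSpec J κ outs).idx u 0 := by
  rw [H.resAt_eq J κ outs]
  refine (H.vsbrSpec J κ outs).resIdx_lt_idx (lt_of_lt_of_le ?_ hu)
  exact unit_lt le_rfl b

/-! ### Values of the stages -/

omit [Fintype ι] [Inhabited ι] in
/-- The affine leaves sum to the atom's value when it has total degree `≤ 1` and there are at least
`#σ + 1` leaves. [cite: BurgisserClausenShokrollahi1997, Thm. (21.36) (proof, (F)), p. 567] -/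
theorem sum_affLeaf (P : ArithCircuit k σ) (a : Atom ι) {K : ℕ} (hK : Fintype.card σ + 1 ≤ K)
    (hdeg : (H.aval a).totalDegree ≤ 1) :
    ∑ τ ∈ Finset.range K, (H.affLeaf a τ).1 • (H.affLeaf a τ).2.valE P = H.aval a := by
  obtain ⟨r, hr⟩ := Nat.exists_eq_add_of_le hK
  rw [hr, Finset.sum_range_add, Finset.sum_range_succ]
  have htail : ∑ x ∈ Finset.range r, (H.affLeaf a (Fintype.card σ + 1 + x)).1 •
      (H.affLeaf a (Fintype.card σ + 1 + x)).2.valE P = 0 := by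
    refine Finset.sum_eq_zero fun x _ => ?_
    unfold affLeaf
    rw [dif_neg (by omega), if_neg (by omega)]
    exact zero_smul _ _
  have hmid : (H.affLeaf a (Fintype.card σ)).1 • (H.affLeaf a (Fintype.card σ)).2.valE P =
      C (coeff 0 (H.aval a)) := by
    unfold affLeaf
    rw [dif_neg (lt_irrefl _), if_pos rfl]
    simp [smul_eq_C_mul]
  have hhead : ∑ x ∈ Finset.range (Fintype.card σ), (H.affLeaf a x).1 • (H.affLeaf a x).2.valE P =
      ∑ v : σ, coeff (Finsupp.single v 1) (H.aval a) • X v := by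
    rw [Finset.sum_range]
    have hf : ∀ i : Fin (Fintype.card σ), (H.affLeaf a i).1 • (H.affLeaf a i).2.valE P =
        coeff (Finsupp.single ((Fintype.equivFin σ).symm i) 1) (H.aval a) •
          X ((Fintype.equivFin σ).symm i) := fun i => by
      unfold affLeaf
      rw [dif_pos i.isLt]
      rfl
    simp only [hf]
    exact Equiv.sum_comp (Fintype.equivFin σ).symm
      (fun v => coeff (Finsupp.single v 1) (H.aval a) • X v)
  rw [htail, add_zero, hmid, hhead, ← eq_sum_smul_X_add_C hdeg]

/-- **Correctness of the stages** (BCS 1997, proof of Thm. (21.36), (F)–(H); VSBR 1983): with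
`K = 2^κ ≥ #ι², #σ + 1`, the result gate of (stage `j ≤ J`, atom `a`) computes the value of `a`
whenever `a` has formal degree `≤ 2^j`. Stage `0`: affine atoms (`sum_affLeaf`); stage `j + 1`:
a copy of stage `j`, or the sum over the terms of `expandAtom a` of the products of their atoms,
all of formal degree `≤ 2^j` (`expandAtom_half`), hence correct at stage `j`; `expandAtom_sum`.
[cite: BurgisserClausenShokrollahi1997, Thm. (21.36) (proof, (F)–(H)), pp. 567–568] -/
theorem gateVal_resAt (hκ : 1 ≤ κ) (hM : Fintype.card ι * Fintype.card ι ≤ 2 ^ κ)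
    (hN : Fintype.card σ + 1 ≤ 2 ^ κ) :
    ∀ j, j ≤ J → ∀ a : Atom ι, H.adeg a ≤ 2 ^ j →
      (H.vsbrSpec J κ outs).circuit.gateVal (resAt κ j a) = H.aval a
  | 0, _, a, ha => by
    have hu := H.unit_lt_U J κ outs (Nat.zero_le J) a
    have hleaf : ∀ τ, (H.vsbrSpec J κ outs).leaf (Fintype.card (Atom ι) * 0 + aIdx a) τ =
        H.affLeaf a τ := fun τ => by
      show H.vsbrLeaf J κ outs _ τ = _
      unfold vsbrLeaf
      rw [if_pos (unit_lt (Nat.zero_le J) a), if_pos (unit_div 0 a), unit_mod, aOf_aIdx]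
    rw [H.resAt_eq J κ outs, (H.vsbrSpec J κ outs).gateVal_result hu hκ ?_]
    · simp only [UnitSpec.leafVal, hleaf]
      exact H.sum_affLeaf _ a hN ((H.totalDegree_aval_le a).trans (by simpa using ha))
    · intro τ _
      rw [hleaf]
      unfold affLeaf
      split_ifs <;> trivial
  | j + 1, hj, a, ha => by
    have hu := H.unit_lt_U J κ outs hj a
    have hult := unit_lt hj a
    have hdiv := unit_div (j + 1) a
    have hmod := unit_mod (j + 1) a
    have ih := fun b hb => gateVal_resAt hκ hM hN j (Nat.le_of_succ_le hj) b hb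
    rw [H.resAt_eq J κ outs]
    by_cases h1 : H.adeg a ≤ 1
    · -- an affine atom: copy stage `j`
      have hleaf : ∀ τ, (H.vsbrSpec J κ outs).leaf (Fintype.card (Atom ι) * (j + 1) + aIdx a) τ =
          if τ = 0 then (1, .gate (resAt κ j a)) else (0, .const 0) := fun τ => by
        show H.vsbrLeaf J κ outs _ τ = _
        unfold vsbrLeaf
        rw [if_pos hult, if_neg (by rw [hdiv]; exact Nat.succ_ne_zero j), hmod, aOf_aIdx, if_pos h1,
          hdiv, Nat.add_sub_cancel]
      rw [(H.vsbrSpec J κ outs).gateVal_result hu hκ ?_]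
      · rw [Finset.sum_eq_single 0]
        · simp only [UnitSpec.leafVal, hleaf, if_true, one_smul, Operand.valE_gate]
          exact ih a (h1.trans Nat.one_le_two_pow)
        · intro τ _ hτ0
          simp only [UnitSpec.leafVal, hleaf, if_neg hτ0, zero_smul]
        · intro h0
          exact absurd (Finset.mem_range.2 (H.vsbrSpec J κ outs).one_le_K) h0
      · intro τ _
        rw [hleaf]
        split_ifs
        · exact (H.resAt_lt_idx J κ outs a (Nat.le_add_right _ _)).trans_le
            ((H.vsbrSpec J κ outs).idx_le_idx_iff.2 (Nat.zero_le _))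
        · trivial
    · -- expansion
      have h2 : 2 ≤ H.adeg a := by omega
      have hleaf : ∀ τ, (H.vsbrSpec J κ outs).leaf (Fintype.card (Atom ι) * (j + 1) + aIdx a) τ =
          (1, .gate (unitG κ * (Fintype.card (Atom ι) * (j + 1) + aIdx a) + (4 * τ + 3))) :=
        fun τ => by
        show H.vsbrLeaf J κ outs _ τ = _
        unfold vsbrLeaf
        rw [if_pos hult, if_neg (by rw [hdiv]; exact Nat.succ_ne_zero j), hmod, aOf_aIdx, if_neg h1]
      have hpop : ∀ τ q,
          (H.vsbrSpec J κ outs).popnd (Fintype.card (Atom ι) * (j + 1) + aIdx a) τ q =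
          ((H.expandAtom a)[τ]?).elim (.const 0) fun T =>
            (T[q]?).elim (.const 1) fun b => .gate (resAt κ j b) := fun τ q => by
        show H.vsbrPopnd J κ _ τ q = _
        unfold vsbrPopnd
        rw [if_pos ⟨by rw [hdiv]; exact Nat.succ_pos j, hult⟩, hmod, aOf_aIdx, hdiv,
          Nat.add_sub_cancel]
      have hpopref : ∀ τ q, ((H.vsbrSpec J κ outs).popnd
          (Fintype.card (Atom ι) * (j + 1) + aIdx a) τ q).RefsBelow
          ((H.vsbrSpec J κ outs).idx (Fintype.card (Atom ι) * (j + 1) + aIdx a) 0) := fun τ q => by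
        rw [hpop]
        cases (H.expandAtom a)[τ]? with
        | none => trivial
        | some T =>
          simp only [Option.elim_some]
          cases T[q]? with
          | none => trivial
          | some b => exact H.resAt_lt_idx J κ outs b (Nat.le_add_right _ _)
      -- the value of an operand of a term read at stage `j`
      have hval : ∀ {T : List (Atom ι)}, T ∈ H.expandAtom a → ∀ q : ℕ,
          (((T[q]?).elim (.const 1) fun b => Operand.gate (resAt κ j b) : Operand k σ).valE
            (H.vsbrSpec J κ outs).circuit) = (T[q]?).elim 1 H.aval := fun {T} hT q => by
        cases hq : T[q]? with
        | none => simp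
        | some b =>
          simp only [Option.elim_some, Operand.valE_gate]
          refine ih b ?_
          have := H.expandAtom_half hT b (List.mem_of_getElem? hq)
          rw [pow_succ] at ha
          omega
      rw [(H.vsbrSpec J κ outs).gateVal_result hu hκ ?_]
      · have hK : (H.expandAtom a).length ≤ (H.vsbrSpec J κ outs).K :=
          (H.length_expandAtom_le a).trans hM
        rw [← H.expandAtom_sum h2, ← sum_range_getElem?_elim H.tval _ _ hK]
        refine Finset.sum_congr rfl fun τ hτ => ?_
        rw [Finset.mem_range] at hτ
        simp only [UnitSpec.leafVal, hleaf, one_smul, Operand.valE_gate]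
        change (H.vsbrSpec J κ outs).circuit.gateVal
          ((H.vsbrSpec J κ outs).idx (Fintype.card (Atom ι) * (j + 1) + aIdx a) (4 * τ + 3)) = _
        rw [(H.vsbrSpec J κ outs).gateVal_prod_three hu hτ (hpopref τ)]
        simp only [hpop]
        cases hTτ : (H.expandAtom a)[τ]? with
        | none => simp
        | some T =>
          have hT : T ∈ H.expandAtom a := List.mem_of_getElem? hTτ
          simp only [Option.elim_some, hval hT]
          exact prod_range_getElem?_elim H.aval T 5 (H.expandAtom_length_le hT)
      · intro τ hτ
        rw [hleaf]
        exact (H.vsbrSpec J κ outs).idx_lt_idx_iff.2 (by omega)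

/-- **The final unit** sums the values of the listed nodes (all of formal degree `≤ 2^J`).
[cite: BurgisserClausenShokrollahi1997, Thm. (21.36) (proof, (F)) and Lemma (21.25), pp. 565–567] -/
theorem gateVal_final (hκ : 1 ≤ κ) (hM : Fintype.card ι * Fintype.card ι ≤ 2 ^ κ)
    (hN : Fintype.card σ + 1 ≤ 2 ^ κ) (hout : outs.length ≤ 2 ^ κ)
    (hJ : ∀ ν ∈ outs, H.deg ν ≤ 2 ^ J) :
    (H.vsbrSpec J κ outs).circuit.gateVal
        ((H.vsbrSpec J κ outs).resIdx (Fintype.card (Atom ι) * (J + 1))) =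
      (outs.map H.val).sum := by
  have hu : Fintype.card (Atom ι) * (J + 1) < (H.vsbrSpec J κ outs).U := Nat.lt_succ_self _
  have hleaf : ∀ τ, (H.vsbrSpec J κ outs).leaf (Fintype.card (Atom ι) * (J + 1)) τ =
      (outs[τ]?).elim (0, .const 0) fun ν => (1, .gate (resAt κ J (.node ν))) := fun τ => by
    show H.vsbrLeaf J κ outs _ τ = _
    unfold vsbrLeaf
    rw [if_neg (lt_irrefl _)]
  rw [(H.vsbrSpec J κ outs).gateVal_result hu hκ ?_]
  · rw [← sum_range_getElem?_elim H.val outs _ hout]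
    refine Finset.sum_congr rfl fun τ _ => ?_
    simp only [UnitSpec.leafVal, hleaf]
    cases hτ : outs[τ]? with
    | none => simp
    | some ν =>
      simp only [Option.elim_some, one_smul, Operand.valE_gate]
      exact H.gateVal_resAt J κ outs hκ hM hN J le_rfl (.node ν) (hJ ν (List.mem_of_getElem? hτ))
  · intro τ _
    rw [hleaf]
    cases outs[τ]? with
    | none => trivial
    | some ν =>
      exact (H.resAt_lt_idx J κ outs (.node ν) le_rfl).trans_le
        ((H.vsbrSpec J κ outs).idx_le_idx_iff.2 (Nat.zero_le _))

/-! ### Depths of the stages -/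

/-- **Depth of the stages**: the result gate of (stage `j`, atom `a`) has depth at most
`(j + 1)(κ + 5)` — every stage costs one product chain (`4`) and one sum tree (`κ + 1`)
(BCS 1997, proof of Thm. (21.36): `⌈log d⌉` stages of depth `O(log r)` each).
[cite: BurgisserClausenShokrollahi1997, Thm. (21.36) (proof, (F)–(H)), pp. 567–568] -/
theorem gateD_resAt_le (hκ : 1 ≤ κ) :
    ∀ j, j ≤ J → ∀ a : Atom ι,
      (H.vsbrSpec J κ outs).circuit.gateD (resAt κ j a) ≤ (j + 1) * (κ + 5)
  | 0, _, a => by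
    have hu := H.unit_lt_U J κ outs (Nat.zero_le J) a
    have hleaf : ∀ τ, (H.vsbrSpec J κ outs).leaf (Fintype.card (Atom ι) * 0 + aIdx a) τ =
        H.affLeaf a τ := fun τ => by
      show H.vsbrLeaf J κ outs _ τ = _
      unfold vsbrLeaf
      rw [if_pos (unit_lt (Nat.zero_le J) a), if_pos (unit_div 0 a), unit_mod, aOf_aIdx]
    rw [H.resAt_eq J κ outs]
    refine ((H.vsbrSpec J κ outs).gateD_result_le hu hκ (D := 0) ?_).trans
      (by show 0 + κ + 1 ≤ _; omega)
    intro τ _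
    rw [hleaf]
    unfold affLeaf
    split_ifs <;> simp
  | j + 1, hj, a => by
    have hu := H.unit_lt_U J κ outs hj a
    have hult := unit_lt hj a
    have hdiv := unit_div (j + 1) a
    have hmod := unit_mod (j + 1) a
    have ih := fun b => gateD_resAt_le hκ j (Nat.le_of_succ_le hj) b
    have hring : (j + 1 + 1) * (κ + 5) = ((j + 1) * (κ + 5) + 4) + κ + 1 := by ring
    rw [H.resAt_eq J κ outs, hring]
    refine (H.vsbrSpec J κ outs).gateD_result_le hu hκ fun τ hτ => ?_
    show (H.vsbrLeaf J κ outs _ τ).2.depE _ ≤ _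
    unfold vsbrLeaf
    rw [if_pos hult, if_neg (by rw [hdiv]; exact Nat.succ_ne_zero j), hmod, aOf_aIdx, hdiv,
      Nat.add_sub_cancel]
    by_cases h1 : H.adeg a ≤ 1
    · rw [if_pos h1]
      split_ifs
      · exact (ih a).trans (Nat.le_add_right _ _)
      · simp
    · rw [if_neg h1]
      simp only [Operand.depE_gate]
      change (H.vsbrSpec J κ outs).circuit.gateD
        ((H.vsbrSpec J κ outs).idx (Fintype.card (Atom ι) * (j + 1) + aIdx a) (4 * τ + 3)) ≤ _
      refine (H.vsbrSpec J κ outs).gateD_prod_three_le hu hτ fun q => ?_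
      show (H.vsbrPopnd J κ _ τ q).depE _ ≤ _
      unfold vsbrPopnd
      rw [if_pos ⟨by rw [hdiv]; exact Nat.succ_pos j, hult⟩, hmod, aOf_aIdx, hdiv,
        Nat.add_sub_cancel]
      cases (H.expandAtom a)[τ]? with
      | none => simp
      | some T =>
        simp only [Option.elim_some]
        cases T[q]? with
        | none => simp
        | some b => exact ih b

/-- The result gate of the final unit has depth at most `(J + 2)(κ + 5)`.
[cite: BurgisserClausenShokrollahi1997, Thm. (21.36) (proof, (F)), p. 567] -/
theorem gateD_final_le (hκ : 1 ≤ κ) :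
    (H.vsbrSpec J κ outs).circuit.gateD
        ((H.vsbrSpec J κ outs).resIdx (Fintype.card (Atom ι) * (J + 1))) ≤ (J + 2) * (κ + 5) := by
  have hu : Fintype.card (Atom ι) * (J + 1) < (H.vsbrSpec J κ outs).U := Nat.lt_succ_self _
  have hring : (J + 2) * (κ + 5) = ((J + 1) * (κ + 5) + 4) + κ + 1 := by ring
  rw [hring]
  refine (H.vsbrSpec J κ outs).gateD_result_le hu hκ fun τ _ => ?_
  show (H.vsbrLeaf J κ outs _ τ).2.depE _ ≤ _
  unfold vsbrLeaf
  rw [if_neg (lt_irrefl _)]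
  cases outs[τ]? with
  | none => simp
  | some ν => exact (H.gateD_resAt_le J κ outs hκ J le_rfl (.node ν)).trans (Nat.le_add_right _ _)

/-! ### The circuit of a homogeneous circuit certificate -/

/-- **The VSBR circuit of a homogeneous circuit certificate** (BCS 1997, Thm. (21.36), (C)–(H);
VSBR 1983): for `κ ≥ 1` with `2^κ ≥ #ι², #σ + 1, |outs|` and all listed nodes of formal degree
`≤ 2^J`, there is a fan-in-two circuit computing `Σ_{ν ∈ outs} [ν]` with
`(4·2^κ + 2^κ κ + 1)(A (J+1) + 1)` gates (`A = #ι + #ι²`) and depth `≤ (J + 2)(κ + 5)`.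
[cite: BurgisserClausenShokrollahi1997, Thm. (21.36), p. 565; ValiantSkyumBerkowitzRackoff1983] -/
theorem exists_circuit_depth {J κ : ℕ} (hκ : 1 ≤ κ) (hM : Fintype.card ι * Fintype.card ι ≤ 2 ^ κ)
    (hN : Fintype.card σ + 1 ≤ 2 ^ κ) (hout : outs.length ≤ 2 ^ κ)
    (hJ : ∀ ν ∈ outs, H.deg ν ≤ 2 ^ J) :
    ∃ P : ArithCircuit k σ, P.IsFanInTwo ∧ P.eval = (outs.map H.val).sum ∧
      P.size = (4 * 2 ^ κ + 2 ^ κ * κ + 1) * (Fintype.card (Atom ι) * (J + 1) + 1) ∧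
      P.depth ≤ (J + 2) * (κ + 5) := by
  have hU : 1 ≤ (H.vsbrSpec J κ outs).U := Nat.succ_pos _
  have hU1 : (H.vsbrSpec J κ outs).U - 1 = Fintype.card (Atom ι) * (J + 1) := rfl
  refine ⟨(H.vsbrSpec J κ outs).circuit, (H.vsbrSpec J κ outs).isFanInTwo_circuit, ?_, ?_, ?_⟩
  · rw [(H.vsbrSpec J κ outs).eval_circuit hU, hU1]
    exact H.gateVal_final J κ outs hκ hM hN hout hJ
  · rw [(H.vsbrSpec J κ outs).size_circuit]
    rfl
  · refine ((H.vsbrSpec J κ outs).depth_circuit_le hU).trans ?_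
    rw [hU1]
    exact H.gateD_final_le J κ outs hκ

end HomCircuit

/-! ## Part 4. From circuit complexity and degree to polynomial size and `log²` depth -/

section Bounds

variable {k : Type u} [CommSemiring k] {σ : Type v} [Fintype σ]

/-- **Thm. (21.36) for one value of a straight-line program, with exponent bookkeeping**
(BCS 1997, Lemma (21.25) + Thm. (21.36); VSBR 1983): if a value of a straight-line program of
length `L ≤ 2^E` has total degree `≤ d`, `d + 1 ≤ 2^E`, over `≤ 2^E - 1` variables (`E ≥ 1`), it
has a fan-in-two circuit of size `≤ 2^{28E}` and depth `≤ 45 E²`: homogenize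
(`SLP.homogenize d`, `≤ 2^{3E+2}` nodes), run `HomCircuit.exists_circuit_depth` with
`κ = 6E + 4`, `J = E` on the `d + 1` homogeneous components of the value, and sum them
(`sum_homogeneousComponent_of_le`).
[cite: BurgisserClausenShokrollahi1997, Lemma (21.25) and Thm. (21.36), pp. 551, 565] -/
theorem SLP.exists_circuit_depth (S : SLP k σ) {i : ℕ} (hi : i < S.len) {d E : ℕ} (hE : 1 ≤ E)
    (hdeg : (S.val i).totalDegree ≤ d) (hd : d + 1 ≤ 2 ^ E) (hN : Fintype.card σ + 1 ≤ 2 ^ E)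
    (hL : S.len ≤ 2 ^ E) :
    ∃ P : ArithCircuit k σ, P.IsFanInTwo ∧ P.eval = S.val i ∧
      P.size ≤ 2 ^ (28 * E) ∧ P.depth ≤ 45 * E ^ 2 := by
  classical
  haveI : Inhabited (S.Node d) := ⟨(⟨i, hi⟩, SLP.Tag.Q 0)⟩
  let outs : List (S.Node d) := (List.finRange (d + 1)).map fun e => (⟨i, hi⟩, SLP.Tag.Q e)
  -- the parameters
  have hM : Fintype.card (S.Node d) ≤ 2 ^ (3 * E + 2) := by
    refine (S.card_node_le d).trans ?_
    calc 4 * S.len * (d + 1) ^ 2 ≤ 4 * 2 ^ E * (2 ^ E) ^ 2 :=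
          Nat.mul_le_mul (Nat.mul_le_mul_left 4 hL) (Nat.pow_le_pow_left hd 2)
      _ = 2 ^ (2 + E + E * 2) := by rw [pow_add, pow_add, pow_mul]; norm_num
      _ = 2 ^ (3 * E + 2) := by congr 1; ring
  have hMM : Fintype.card (S.Node d) * Fintype.card (S.Node d) ≤ 2 ^ (6 * E + 4) := by
    calc _ ≤ 2 ^ (3 * E + 2) * 2 ^ (3 * E + 2) := Nat.mul_le_mul hM hM
      _ = 2 ^ (6 * E + 4) := by rw [← pow_add]; congr 1; ring
  have hκ : 1 ≤ 6 * E + 4 := by omega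
  have hNκ : Fintype.card σ + 1 ≤ 2 ^ (6 * E + 4) :=
    hN.trans (Nat.pow_le_pow_right (by norm_num) (by omega))
  have hout : outs.length ≤ 2 ^ (6 * E + 4) := by
    simp only [outs, List.length_map, List.length_finRange]
    exact hd.trans (Nat.pow_le_pow_right (by norm_num) (by omega))
  have hJ : ∀ ν ∈ outs, (S.homogenize d).deg ν ≤ 2 ^ E := by
    intro ν hν
    obtain ⟨e, -, rfl⟩ := List.mem_map.1 hν
    show e.val ≤ 2 ^ E
    have := e.isLt
    omega
  obtain ⟨P, hfan, heval, hsize, hdepth⟩ :=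
    (S.homogenize d).exists_circuit_depth outs hκ hMM hNκ hout hJ
  refine ⟨P, hfan, ?_, ?_, ?_⟩
  · -- the value: sum of the homogeneous components
    rw [heval, List.map_map]
    have hfun :
        ((S.homogenize d).val ∘ fun e : Fin (d + 1) => ((⟨i, hi⟩ : Fin S.len), SLP.Tag.Q e)) =
        fun e : Fin (d + 1) => homogeneousComponent (e : ℕ) (S.val i) := by
      funext e; rfl
    rw [hfun, ← Fin.sum_univ_def, Fin.sum_univ_eq_sum_range
      (fun e => homogeneousComponent e (S.val i)) (d + 1), sum_homogeneousComponent_of_le hdeg]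
  · -- the size
    have h2E : E + 1 ≤ 2 ^ E := Nat.lt_two_pow_self
    have hA : Fintype.card (HomCircuit.Atom (S.Node d)) ≤ 2 ^ (6 * E + 5) := by
      rw [HomCircuit.card_atom]
      calc Fintype.card (S.Node d) + Fintype.card (S.Node d) * Fintype.card (S.Node d)
          ≤ 2 ^ (3 * E + 2) + 2 ^ (6 * E + 4) := Nat.add_le_add hM hMM
        _ ≤ 2 ^ (6 * E + 4) + 2 ^ (6 * E + 4) :=
          Nat.add_le_add_right (Nat.pow_le_pow_right (by norm_num) (by omega)) _
        _ = 2 ^ (6 * E + 5) := by rw [pow_succ]; ring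
    have hU : Fintype.card (HomCircuit.Atom (S.Node d)) * (E + 1) + 1 ≤ 2 ^ (7 * E + 6) := by
      have h1 : 1 ≤ 2 ^ (6 * E + 5) * 2 ^ E := by rw [← pow_add]; exact Nat.one_le_two_pow
      calc Fintype.card (HomCircuit.Atom (S.Node d)) * (E + 1) + 1
          ≤ 2 ^ (6 * E + 5) * 2 ^ E + 2 ^ (6 * E + 5) * 2 ^ E :=
            Nat.add_le_add (Nat.mul_le_mul hA h2E) h1
        _ = 2 ^ (7 * E + 6) := by rw [← pow_add, ← two_mul, ← pow_succ']; congr 1; ring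
    have hG : 4 * 2 ^ (6 * E + 4) + 2 ^ (6 * E + 4) * (6 * E + 4) + 1 ≤ 2 ^ (7 * E + 8) := by
      have hk : 6 * E + 4 + 4 ≤ 2 ^ (E + 3) := by
        calc 6 * E + 4 + 4 ≤ 8 * (E + 1) := by omega
          _ ≤ 8 * 2 ^ E := Nat.mul_le_mul_left 8 h2E
          _ = 2 ^ (E + 3) := by rw [pow_add]; ring
      have h1 : 1 ≤ 2 ^ (6 * E + 4) * 2 ^ (E + 3) := by rw [← pow_add]; exact Nat.one_le_two_pow
      calc 4 * 2 ^ (6 * E + 4) + 2 ^ (6 * E + 4) * (6 * E + 4) + 1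
          = 2 ^ (6 * E + 4) * (6 * E + 4 + 4) + 1 := by ring
        _ ≤ 2 ^ (6 * E + 4) * 2 ^ (E + 3) + 2 ^ (6 * E + 4) * 2 ^ (E + 3) :=
            Nat.add_le_add (Nat.mul_le_mul_left _ hk) h1
        _ = 2 ^ (7 * E + 8) := by rw [← pow_add, ← two_mul, ← pow_succ']; congr 1; ring
    rw [hsize]
    calc (4 * 2 ^ (6 * E + 4) + 2 ^ (6 * E + 4) * (6 * E + 4) + 1) *
          (Fintype.card (HomCircuit.Atom (S.Node d)) * (E + 1) + 1)
        ≤ 2 ^ (7 * E + 8) * 2 ^ (7 * E + 6) := Nat.mul_le_mul hG hU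
      _ = 2 ^ (14 * E + 14) := by rw [← pow_add]; congr 1; ring
      _ ≤ 2 ^ (28 * E) := Nat.pow_le_pow_right (by norm_num) (by omega)
  · -- the depth
    refine hdepth.trans ?_
    calc (E + 2) * (6 * E + 4 + 5) ≤ (3 * E) * (15 * E) := Nat.mul_le_mul (by omega) (by omega)
      _ = 45 * E ^ 2 := by ring

/-- **Thm. (21.36) in the tree's circuit model** (BCS 1997; Hyafil 1979; VSBR 1983): if
`deg g + 1, #σ + 1, L(g) ≤ 2^E` (`E ≥ 1`, `L` = `complexity`, the fan-in-two gate count), then `g`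
has a fan-in-two circuit of size `≤ 2^{28E}` and depth `≤ 45E²` — via a size-minimal circuit
(`ArithCircuit.exists_computes_size_eq_complexity`), its straight-line program
(`DepthReduction.exists_slp`) and `SLP.exists_circuit_depth`; a variable or constant output is the
gate-free case. [cite: BurgisserClausenShokrollahi1997, Thm. (21.36), p. 565] -/
theorem exists_circuit_of_two_pow_bounds {g : MvPolynomial σ k} {d E : ℕ} (hE : 1 ≤ E)
    (hdeg : g.totalDegree ≤ d) (hd : d + 1 ≤ 2 ^ E) (hN : Fintype.card σ + 1 ≤ 2 ^ E)
    (hL : complexity g ≤ 2 ^ E) :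
    ∃ P : ArithCircuit k σ, P.IsFanInTwo ∧ P.Computes g ∧
      P.size ≤ 2 ^ (28 * E) ∧ P.depth ≤ 45 * E ^ 2 := by
  obtain ⟨P₀, hfan, hcomp, hsize⟩ := ArithCircuit.exists_computes_size_eq_complexity g
  obtain ⟨S, hlen, hcases⟩ := exists_slp P₀ hfan
  rw [show P₀.eval = g from hcomp] at hcases
  rcases hcases with ⟨i, hi, hgi⟩ | ⟨j, hgj⟩ | ⟨c, hgc⟩
  · have hdi : (S.val i).totalDegree ≤ d := by rw [← hgi]; exact hdeg
    have hSl : S.len ≤ 2 ^ E := by rw [hlen, hsize]; exact hL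
    obtain ⟨P, h1, h2, h3, h4⟩ := S.exists_circuit_depth hi hE hdi hd hN hSl
    exact ⟨P, h1, h2.trans hgi.symm, h3, h4⟩
  · refine ⟨ArithCircuit.ofVar j, ArithCircuit.IsFanInTwo.ofVar j, ?_, by simp, by simp⟩
    show (ArithCircuit.ofVar j).eval = g
    rw [ArithCircuit.eval_ofVar, hgj]
  · refine ⟨ArithCircuit.ofConst c, ArithCircuit.IsFanInTwo.ofConst c, ?_, by simp, by simp⟩
    show (ArithCircuit.ofConst c).eval = g
    rw [ArithCircuit.eval_ofConst, hgc]

end Bounds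

/-! ### The family statement -/

/-- `2^{log₂ n + 1} ≤ 2 (n + 1)` (a private copy of an elementary estimate also proved, under the
same short name, in `Literature/Computability/MetaComplexity/GapMINKTCodeAdvice.lean`, which is not
worth importing here). [folklore] -/
private theorem two_pow_log_succ_le (n : ℕ) : 2 ^ (Nat.log 2 n + 1) ≤ 2 * (n + 1) := by
  rcases Nat.eq_zero_or_pos n with rfl | hn
  · simp
  · rw [pow_succ]
    have := Nat.pow_log_le_self 2 hn.ne'
    omega

/-- **`VP ⊆ VNC²` over every commutative semiring** (BCS 1997, Cor. (21.38) via Thm. (21.36);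
VSBR 1983): for a `VP` family `f` — `#σₙ, deg fₙ, L(fₙ) < 2^{(log₂ n + 1)A}` by
`IsPBounded.exists_lt_two_pow` — `exists_circuit_of_two_pow_bounds` with `E = (log₂ n + 1) A`
gives fan-in-two circuits of size `≤ 2^{28 (log₂ n + 1) A} ≤ 2^{28A} (n + 1)^{28A}` (p-bounded)
and depth `≤ 45 A² (log₂ n + 1)²`.
[cite: BurgisserClausenShokrollahi1997, Cor. (21.38) and Def. (21.37), pp. 568–569] -/
theorem exists_isPBounded_size_depth_le_of_isVPFamily {k : Type u} [CommSemiring k]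
    {σ : ℕ → Type v} [∀ n, Fintype (σ n)] (f : ∀ n, MvPolynomial (σ n) k) (hf : IsVPFamily f) :
    ∃ (c : ℕ) (s : ℕ → ℕ), IsPBounded s ∧ ∀ n : ℕ, ∃ P : ArithCircuit k (σ n),
      P.IsFanInTwo ∧ P.Computes (f n) ∧ P.size ≤ s n ∧ P.depth ≤ c * (Nat.log 2 n + 1) ^ 2 := by
  obtain ⟨⟨hN, hdeg⟩, hL⟩ := hf
  obtain ⟨A₁, hA₁, h₁⟩ := IsPBounded.exists_lt_two_pow hN
  obtain ⟨A₂, -, h₂⟩ := IsPBounded.exists_lt_two_pow hdeg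
  obtain ⟨A₃, -, h₃⟩ := IsPBounded.exists_lt_two_pow hL
  refine ⟨45 * (A₁ + A₂ + A₃) ^ 2, fun n => 2 ^ (28 * ((Nat.log 2 n + 1) * (A₁ + A₂ + A₃))),
    ?_, fun n => ?_⟩
  · refine (IsPBounded.iff_exists_le_mul_succ_pow _).2
      ⟨2 ^ (28 * (A₁ + A₂ + A₃)), 28 * (A₁ + A₂ + A₃), fun n => ?_⟩
    calc 2 ^ (28 * ((Nat.log 2 n + 1) * (A₁ + A₂ + A₃)))
        = (2 ^ (Nat.log 2 n + 1)) ^ (28 * (A₁ + A₂ + A₃)) := by rw [← pow_mul]; congr 1; ring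
      _ ≤ (2 * (n + 1)) ^ (28 * (A₁ + A₂ + A₃)) := Nat.pow_le_pow_left (two_pow_log_succ_le n) _
      _ = 2 ^ (28 * (A₁ + A₂ + A₃)) * (n + 1) ^ (28 * (A₁ + A₂ + A₃)) := mul_pow _ _ _
  · have hE1 : 1 ≤ (Nat.log 2 n + 1) * (A₁ + A₂ + A₃) := Nat.mul_pos (Nat.succ_pos _) (by omega)
    have hpow : ∀ {B : ℕ}, B ≤ A₁ + A₂ + A₃ →
        2 ^ ((Nat.log 2 n + 1) * B) ≤ 2 ^ ((Nat.log 2 n + 1) * (A₁ + A₂ + A₃)) := fun hB =>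
      Nat.pow_le_pow_right (by norm_num) (Nat.mul_le_mul_left _ hB)
    have hn : Fintype.card (σ n) + 1 ≤ 2 ^ ((Nat.log 2 n + 1) * (A₁ + A₂ + A₃)) :=
      (Nat.succ_le_of_lt (h₁ n)).trans (hpow (by omega))
    have hd : (f n).totalDegree + 1 ≤ 2 ^ ((Nat.log 2 n + 1) * (A₁ + A₂ + A₃)) :=
      (Nat.succ_le_of_lt (h₂ n)).trans (hpow (by omega))
    have hc : complexity (f n) ≤ 2 ^ ((Nat.log 2 n + 1) * (A₁ + A₂ + A₃)) :=
      ((h₃ n).trans_le (hpow (by omega))).le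
    obtain ⟨P, h1, h2, h3, h4⟩ := exists_circuit_of_two_pow_bounds hE1 le_rfl hd hn hc
    refine ⟨P, h1, h2, h3, h4.trans (le_of_eq ?_)⟩
    ring

end DepthReduction

/-! ## The discharge -/

/-- **Discharge of `BCS1997_cor_21_38_VP_subset_VNC2`** (Bürgisser–Clausen–Shokrollahi 1997,
Cor. (21.38) "`VP = VNC²` for every field", the inclusion `VP ⊆ VNC²`, via Thm. (21.36) of
Hyafil and Valiant–Skyum–Berkowitz–Rackoff): every `VP` family over a field `k` has fan-in-two
circuits of p-bounded size and depth `≤ c (⌊log₂ n⌋ + 1)²`. The instance `Field k` of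
`DepthReduction.exists_isPBounded_size_depth_le_of_isVPFamily` (any commutative semiring).
[cite: BurgisserClausenShokrollahi1997, Cor. (21.38), Def. (21.37), Thm. (21.36), pp. 565–569] -/
theorem BCS1997_cor_21_38_VP_subset_VNC2_holds : BCS1997_cor_21_38_VP_subset_VNC2 :=
  fun _k _ _σ _ f hf => DepthReduction.exists_isPBounded_size_depth_le_of_isVPFamily f hf

end Literature.Computability.AlgebraicComplexity
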